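import Literature.Computability.QuantumComplexity.QuadraticCodeFP
import Literature.Computability.QuantumComplexity.ExactCompilerInstances
import Literature.Computability.Complexity.CodeFPBudgets
import HarnessLib

/-!
# Typed polynomial time for the braid compiler, I: matrices, candidates, tests, capped folds

Topic `Literature/Computability/QuantumComplexity`. String-level layer of the
`PromiseBQP`-hardness of the Jones polynomial (Aharonov–Arad 2011, Thm. 3.1, §3.3: the classical
pre-compilation runs in polynomial time), continuing `QuadraticCodeFP.lean`. In the typed `FP`
algebra `CodeFP`:

* `matE` — the code of a `2 × 2` matrix over `K5`; `matMul`, `matAdjK`, `matOne`;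
* `letterE`, `candE` — the codes of letters and of compiler candidates (`ExactCompiler.Cand`);
  `candMul`, `candInv`, `candConj`, `candGcomm`, `candTr2`, `candPow` (power by a unary
  exponent, a fold with a quadratic accumulator bound), the scores `scoreZ/Z'/CZ/H_codeFP` and the
  certificates `smallTest_codeFP`, `reachTest_codeFP`;
* `bestByCtx` — the compiler's arg-min/arg-max scan with a context-dependent key (a fold whose
  accumulator is the default or a list item);
* **`foldlCap`** — a left fold whose step is undone when the accumulator's CODE would exceed a
  unary cap; it is typed polynomial time for any typed step (`foldlCap_codeFP`) and agrees with
  the plain fold when the cap is not reached (`foldlCap_eq_foldl`) — the device by which the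
  compiler's tower and descent (whose words grow geometrically with the depth) are clocked.

## References

* D. Aharonov, I. Arad, New J. Phys. 13 (2011) 035019, §3.3 [AharonovArad2011].
* S. Arora, B. Barak, *Computational Complexity*, CUP 2009, §1.2–1.3 [AroraBarak2009].
-/

namespace Literature.Computability.QuantumComplexity

open Literature.Computability.Complexity Literature.Computability.Complexity.CodeFP ExactCompiler

/-! ### Matrices over `K5` -/

/-- **The code of a `2 × 2` matrix over `K5`**: its four entries. [folklore] -/
def matE (A : Matrix (Fin 2) (Fin 2) K5) : List Bool := pairE (pairE k5E k5E) (pairE k5E k5E) ((A 0 0, A 0 1), (A 1 0, A 1 1))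

/-- The entries as a tuple (same code). [folklore] -/
theorem matEntries : CodeFP matE (pairE (pairE k5E k5E) (pairE k5E k5E)) (fun A => ((A 0 0, A 0 1), (A 1 0, A 1 1))) :=
  CodeFP.transparent fun _ => rfl

/-- The matrix with given entries (same code). [folklore] -/
theorem matOfEntries : CodeFP (pairE (pairE k5E k5E) (pairE k5E k5E)) matE (fun t => !![t.1.1, t.1.2; t.2.1, t.2.2]) :=
  CodeFP.transparent fun _ => rfl

/-- `matE` is injective. [folklore] -/
theorem matE_injective : Function.Injective matE := by
  intro A B h
  have hk : Function.Injective k5E := k5Ring.inj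
  obtain ⟨h1, h2⟩ := Prod.mk.inj (pairE_injective (pairE_injective hk hk) (pairE_injective hk hk) h)
  obtain ⟨h00, h01⟩ := Prod.mk.inj h1
  obtain ⟨h10, h11⟩ := Prod.mk.inj h2
  refine Matrix.ext fun i j => ?_
  fin_cases i <;> fin_cases j <;> assumption

section Entries

variable {α : Type} {eα : α → List Bool}

/-- Entry `(0,0)` pointwise. [folklore] -/
theorem mat00 {g : α → Matrix (Fin 2) (Fin 2) K5} (hg : CodeFP eα matE g) : CodeFP eα k5E (fun a => g a 0 0) :=
  ((fst _ _).fst'.comp (matEntries.comp hg)).congr fun _ => rfl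
/-- Entry `(0,1)` pointwise. [folklore] -/
theorem mat01 {g : α → Matrix (Fin 2) (Fin 2) K5} (hg : CodeFP eα matE g) : CodeFP eα k5E (fun a => g a 0 1) :=
  ((fst _ _).snd'.comp (matEntries.comp hg)).congr fun _ => rfl
/-- Entry `(1,0)` pointwise. [folklore] -/
theorem mat10 {g : α → Matrix (Fin 2) (Fin 2) K5} (hg : CodeFP eα matE g) : CodeFP eα k5E (fun a => g a 1 0) :=
  ((snd _ _).fst'.comp (matEntries.comp hg)).congr fun _ => rfl
/-- Entry `(1,1)` pointwise. [folklore] -/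
theorem mat11 {g : α → Matrix (Fin 2) (Fin 2) K5} (hg : CodeFP eα matE g) : CodeFP eα k5E (fun a => g a 1 1) :=
  ((snd _ _).snd'.comp (matEntries.comp hg)).congr fun _ => rfl

/-- Building a matrix pointwise. [folklore] -/
theorem matMk' {g00 g01 g10 g11 : α → K5} (h00 : CodeFP eα k5E g00) (h01 : CodeFP eα k5E g01) (h10 : CodeFP eα k5E g10)
    (h11 : CodeFP eα k5E g11) : CodeFP eα matE (fun a => !![g00 a, g01 a; g10 a, g11 a]) :=
  (matOfEntries.comp ((h00.pair h01).pair (h10.pair h11))).congr fun _ => rfl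

end Entries

/-- **Matrix multiplication over `K5` is computed on codes.** [cite: AharonovArad2011, §3.3] -/
theorem matMul : CodeFP (pairE matE matE) matE (fun p => p.1 * p.2) := by
  have hA : CodeFP (pairE matE matE) matE Prod.fst := fst _ _
  have hB : CodeFP (pairE matE matE) matE Prod.snd := snd _ _
  refine (matMk' (k5Ring.add' (k5Ring.mul' (mat00 hA) (mat00 hB)) (k5Ring.mul' (mat01 hA) (mat10 hB)))
    (k5Ring.add' (k5Ring.mul' (mat00 hA) (mat01 hB)) (k5Ring.mul' (mat01 hA) (mat11 hB)))
    (k5Ring.add' (k5Ring.mul' (mat10 hA) (mat00 hB)) (k5Ring.mul' (mat11 hA) (mat10 hB)))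
    (k5Ring.add' (k5Ring.mul' (mat10 hA) (mat01 hB)) (k5Ring.mul' (mat11 hA) (mat11 hB)))).congr fun p => ?_
  refine Matrix.ext fun i j => ?_
  fin_cases i <;> fin_cases j <;> simp [Matrix.mul_apply, Fin.sum_univ_two]

/-- Pointwise matrix product. [folklore] -/
theorem matMul' {α : Type} {eα : α → List Bool} {g k : α → Matrix (Fin 2) (Fin 2) K5} (hg : CodeFP eα matE g) (hk : CodeFP eα matE k) :
    CodeFP eα matE (fun a => g a * k a) := by exact (matMul.comp (hg.pair hk) :)

/-- The conjugation of `K5` is computed on codes. [folklore] -/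
theorem cconj_codeFP : CodeFP k5E k5E K5.cconj :=
  (RingCodeFP.qaMk' ((RingCodeFP.qaStar zphiRing).comp RingCodeFP.qaRe) ((RingCodeFP.qaStar zphiRing).comp RingCodeFP.qaIm)).congr
    fun _ => rfl

/-- **The `K5`-adjoint is computed on codes.** [folklore] -/
theorem matAdjK : CodeFP matE matE K5.adjK :=
  (matMk' (cconj_codeFP.comp (mat00 (CodeFP.id _))) (cconj_codeFP.comp (mat10 (CodeFP.id _)))
    (cconj_codeFP.comp (mat01 (CodeFP.id _))) (cconj_codeFP.comp (mat11 (CodeFP.id _)))).congr fun A => by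
    refine Matrix.ext fun i j => ?_
    fin_cases i <;> fin_cases j <;> rfl

/-! ### Letters and candidates -/

/-- The code of a letter: a numeral `0…3`. [folklore] -/
def letterE : Letter → List Bool
  | Letter.x => natE 0
  | Letter.y => natE 1
  | Letter.xi => natE 2
  | Letter.yi => natE 3

/-- `letterE` is injective. [folklore] -/
theorem letterE_injective : Function.Injective letterE := by
  intro a b h; cases a <;> cases b <;> first | rfl | exact absurd (natE_injective h) (by decide)

/-- **The code of a candidate**: word, matrix, inverse word, inverse matrix. [folklore] -/
def candE (c : Cand Letter) : List Bool := pairE (rawE letterE) (pairE matE (pairE (rawE letterE) matE)) (c.word, (c.mat, (c.iword, c.imat)))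

/-- The components as a tuple (same code). [folklore] -/
theorem candParts : CodeFP candE (pairE (rawE letterE) (pairE matE (pairE (rawE letterE) matE))) (fun c => (c.word, (c.mat, (c.iword, c.imat)))) :=
  CodeFP.transparent fun _ => rfl

/-- The candidate with given components (same code). [folklore] -/
theorem candOfParts : CodeFP (pairE (rawE letterE) (pairE matE (pairE (rawE letterE) matE))) candE (fun t => (⟨t.1, t.2.1, t.2.2.1, t.2.2.2⟩ : Cand Letter)) :=
  CodeFP.transparent fun _ => rfl

section CandParts

variable {α : Type} {eα : α → List Bool}

/-- The word pointwise. [folklore] -/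
theorem candWord {g : α → Cand Letter} (hg : CodeFP eα candE g) : CodeFP eα (rawE letterE) (fun a => (g a).word) :=
  ((fst _ _).comp (candParts.comp hg)).congr fun _ => rfl
/-- The matrix pointwise. [folklore] -/
theorem candMat {g : α → Cand Letter} (hg : CodeFP eα candE g) : CodeFP eα matE (fun a => (g a).mat) :=
  ((snd _ _).fst'.comp (candParts.comp hg)).congr fun _ => rfl
/-- The inverse word pointwise. [folklore] -/
theorem candIword {g : α → Cand Letter} (hg : CodeFP eα candE g) : CodeFP eα (rawE letterE) (fun a => (g a).iword) :=
  (((snd _ _).snd'.fst').comp (candParts.comp hg)).congr fun _ => rfl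
/-- The inverse matrix pointwise. [folklore] -/
theorem candImat {g : α → Cand Letter} (hg : CodeFP eα candE g) : CodeFP eα matE (fun a => (g a).imat) :=
  (((snd _ _).snd'.snd').comp (candParts.comp hg)).congr fun _ => rfl

/-- Building a candidate pointwise. [folklore] -/
theorem candMk' {w iw : α → List Letter} {m im : α → Matrix (Fin 2) (Fin 2) K5} (hw : CodeFP eα (rawE letterE) w) (hm : CodeFP eα matE m)
    (hiw : CodeFP eα (rawE letterE) iw) (him : CodeFP eα matE im) : CodeFP eα candE (fun a => (⟨w a, m a, iw a, im a⟩ : Cand Letter)) :=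
  candOfParts.comp (hw.pair (hm.pair (hiw.pair him)))

/-- **The product of candidates is computed on codes.** [cite: AharonovArad2011, §3.3] -/
theorem candMul' {g k : α → Cand Letter} (hg : CodeFP eα candE g) (hk : CodeFP eα candE k) : CodeFP eα candE (fun a => (g a).mul (k a)) := by
  have happ : ∀ {u v : α → List Letter}, CodeFP eα (rawE letterE) u → CodeFP eα (rawE letterE) v → CodeFP eα (rawE letterE) (fun a => u a ++ v a) :=
    fun hu hv => by exact ((rawAppend letterE).comp (hu.pair hv) :)
  exact (candMk' (happ (candWord hg) (candWord hk)) (matMul' (candMat hg) (candMat hk)) (happ (candIword hk) (candIword hg))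
    (matMul' (candImat hk) (candImat hg))).congr fun _ => rfl

/-- The inverse candidate is computed on codes. [folklore] -/
theorem candInv' {g : α → Cand Letter} (hg : CodeFP eα candE g) : CodeFP eα candE (fun a => (g a).inv) :=
  (candMk' (candIword hg) (candImat hg) (candWord hg) (candMat hg)).congr fun _ => rfl

/-- Conjugation `V c V⁻¹` is computed on codes. [folklore] -/
theorem candConj' {g k : α → Cand Letter} (hg : CodeFP eα candE g) (hk : CodeFP eα candE k) : CodeFP eα candE (fun a => (g a).conj (k a)) :=
  (candMul' (candMul' hg hk) (candInv' hg)).congr fun _ => rfl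

/-- The group commutator is computed on codes. [folklore] -/
theorem candGcomm' {g k : α → Cand Letter} (hg : CodeFP eα candE g) (hk : CodeFP eα candE k) : CodeFP eα candE (fun a => (g a).gcomm (k a)) :=
  (candMul' (candMul' (candMul' hg hk) (candInv' hg)) (candInv' hk)).congr fun _ => rfl

/-- `2 Re` of `ℤ[φ][ζ₅]` is computed on codes. [folklore] -/
theorem zzRe2 : CodeFP zzE zphiE ZPhiZeta.re2 :=
  (zphiRing.add' (zphiRing.mul' (RingCodeFP.const' 2) RingCodeFP.qaRe) (zphiRing.mul' (RingCodeFP.const' ZPhi.tau) RingCodeFP.qaIm)).congr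
    fun _ => rfl

/-- `K5.re2` is computed on codes. [folklore] -/
theorem k5Re2 : CodeFP k5E zphisE K5.re2 :=
  (RingCodeFP.qaMk' (zzRe2.comp RingCodeFP.qaRe) (zzRe2.comp RingCodeFP.qaIm)).congr fun _ => rfl

/-- `K5.imC` is computed on codes. [folklore] -/
theorem k5ImC : CodeFP k5E zphisE K5.imC :=
  (RingCodeFP.qaMk' (RingCodeFP.qaIm.comp RingCodeFP.qaRe) (RingCodeFP.qaIm.comp RingCodeFP.qaIm)).congr fun _ => rfl

/-- **The exact trace `tr2` is computed on codes.** [cite: AharonovArad2011, §3.3] -/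
theorem candTr2' {g : α → Cand Letter} (hg : CodeFP eα candE g) : CodeFP eα zphisE (fun a => (g a).tr2) :=
  (k5Re2.comp (k5Ring.add' (mat00 (candMat hg)) (mat11 (candMat hg)))).congr fun _ => rfl

/-- The four scores are computed on codes. [cite: AharonovArad2011, §3.3] -/
theorem scoreZ_codeFP : CodeFP matE zphisE scoreZ := (k5ImC.comp (k5Ring.sub' (mat00 (CodeFP.id _)) (mat11 (CodeFP.id _)))).congr fun _ => rfl
/-- See `scoreZ_codeFP`. [cite: AharonovArad2011, §3.3] -/
theorem scoreZ'_codeFP : CodeFP matE zphisE scoreZ' := (k5ImC.comp (k5Ring.sub' (mat11 (CodeFP.id _)) (mat00 (CodeFP.id _)))).congr fun _ => rfl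
/-- See `scoreZ_codeFP`. [cite: AharonovArad2011, §3.3] -/
theorem scoreCZ_codeFP : CodeFP matE zphisE scoreCZ :=
  (zphisRing.neg' (k5Re2.comp (k5Ring.add' (mat00 (CodeFP.id _)) (mat11 (CodeFP.id _))))).congr fun _ => rfl
/-- See `scoreZ_codeFP`. [cite: AharonovArad2011, §3.3] -/
theorem scoreH_codeFP : CodeFP matE zphisE scoreH :=
  (k5ImC.comp (k5Ring.sub' (k5Ring.add' (k5Ring.add' (mat00 (CodeFP.id _)) (mat01 (CodeFP.id _))) (mat10 (CodeFP.id _)))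
    (mat11 (CodeFP.id _)))).congr fun _ => rfl

/-- Integers into `ℤ[φ][√τ]` are computed on codes. [folklore] -/
theorem zphis_codeFP : CodeFP intE zphisE zphis :=
  (RingCodeFP.qaMk' (RingCodeFP.qaMk' (CodeFP.id intE) (RingCodeFP.const' 0)) (RingCodeFP.const' 0)).congr fun _ => rfl

/-- **The smallness certificate is computed on codes.** [cite: AharonovArad2011, §3.3] -/
theorem smallTest_codeFP : CodeFP (pairE (pairE natE natE) candE) bitE (fun t => smallTest t.1.1 t.1.2 t.2) := by
  have hp : CodeFP (pairE (pairE natE natE) candE) intE (fun t => (t.1.1 : ℤ)) := intOfNat.comp (fst _ _).fst'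
  have hq : CodeFP (pairE (pairE natE natE) candE) intE (fun t => (t.1.2 : ℤ)) := intOfNat.comp (fst _ _).snd'
  have hc : CodeFP (pairE (pairE natE natE) candE) candE (fun t => t.2) := snd _ _
  have q2 := RingCodeFP.int.mul' hq hq
  have q4 := RingCodeFP.int.mul' q2 q2
  have p2 := RingCodeFP.int.mul' hp hp
  have hl : CodeFP (pairE (pairE natE natE) candE) zphisE (fun t => zphis (24 * ((t.1.2 : ℤ) * t.1.2 * (t.1.2 * t.1.2))) * t.2.tr2) :=
    zphisRing.mul' (zphis_codeFP.comp (RingCodeFP.int.mul' (RingCodeFP.const' 24) q4)) (candTr2' hc)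
  have hr : CodeFP (pairE (pairE natE natE) candE) zphisE (fun t => zphis (96 * ((t.1.2 : ℤ) * t.1.2 * (t.1.2 * t.1.2)) -
      48 * ((t.1.1 : ℤ) * t.1.1) * ((t.1.2 : ℤ) * t.1.2) + 5 * ((t.1.1 : ℤ) * t.1.1 * ((t.1.1 : ℤ) * t.1.1)))) :=
    zphis_codeFP.comp (RingCodeFP.int.add' (RingCodeFP.int.sub' (RingCodeFP.int.mul' (RingCodeFP.const' 96) q4)
      (RingCodeFP.int.mul' (RingCodeFP.int.mul' (RingCodeFP.const' 48) p2) q2)) (RingCodeFP.int.mul' (RingCodeFP.const' 5) (RingCodeFP.int.mul' p2 p2)))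
  exact ((zphisLt' hl hr).not).congr fun t => by simp only [smallTest]; congr 3 <;> ring_nf

/-- **The reach certificate is computed on codes.** [cite: AharonovArad2011, §3.3] -/
theorem reachTest_codeFP : CodeFP (pairE (pairE natE natE) candE) bitE (fun t => reachTest t.1.1 t.1.2 t.2) := by
  have hp : CodeFP (pairE (pairE natE natE) candE) intE (fun t => (t.1.1 : ℤ)) := intOfNat.comp (fst _ _).fst'
  have hq : CodeFP (pairE (pairE natE natE) candE) intE (fun t => (t.1.2 : ℤ)) := intOfNat.comp (fst _ _).snd'
  have hc : CodeFP (pairE (pairE natE natE) candE) candE (fun t => t.2) := snd _ _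
  have q2 := RingCodeFP.int.mul' hq hq
  have p2 := RingCodeFP.int.mul' hp hp
  have hl : CodeFP (pairE (pairE natE natE) candE) zphisE (fun t => zphis (4 * ((t.1.2 : ℤ) * t.1.2) - 5 * ((t.1.1 : ℤ) * t.1.1))) :=
    zphis_codeFP.comp (RingCodeFP.int.sub' (RingCodeFP.int.mul' (RingCodeFP.const' 4) q2) (RingCodeFP.int.mul' (RingCodeFP.const' 5) p2))
  have hr : CodeFP (pairE (pairE natE natE) candE) zphisE (fun t => zphis ((t.1.2 : ℤ) * t.1.2) * t.2.tr2) :=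
    zphisRing.mul' (zphis_codeFP.comp q2) (candTr2' hc)
  exact ((zphisLt' hl hr).not).congr fun t => by simp only [reachTest]; congr 3 <;> ring_nf

end CandParts

/-! ### Capped folds -/

section Folds

variable {α β σ : Type} {eα : α → List Bool} {eβ : β → List Bool} {eσ : σ → List Bool}

/-- **A left fold whose step is undone when the new accumulator's code exceeds the cap.** [folklore] -/
def foldlCap (eβ : β → List Bool) (cap : ℕ) (step : σ → α → β → β) (s : σ) (l : List α) (b₀ : β) : β :=
  l.foldl (fun b a => if (eβ (step s a b)).length ≤ cap then step s a b else b) b₀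

/-- Every accumulator of the capped fold is the start value or has code length `≤ cap`. [folklore] -/
theorem length_foldlCap_le (cap : ℕ) (step : σ → α → β → β) (s : σ) (l : List α) (b₀ : β) :
    (eβ (foldlCap eβ cap step s l b₀)).length ≤ max cap (eβ b₀).length := by
  unfold foldlCap
  induction l generalizing b₀ with
  | nil => exact le_max_right _ _
  | cons a l ih =>
    rw [List.foldl_cons]
    refine (ih _).trans (max_le (le_max_left _ _) ?_)
    split_ifs with h
    · exact h.trans (le_max_left _ _)
    · exact le_max_right _ _

/-- **If the cap is never reached, the capped fold is the fold.** [folklore] -/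
theorem foldlCap_eq_foldl {cap : ℕ} {step : σ → α → β → β} {s : σ} {l : List α} {b₀ : β}
    (h : ∀ l₁ l₂ : List α, l₁ ++ l₂ = l → (eβ (l₁.foldl (fun b a => step s a b) b₀)).length ≤ cap) :
    foldlCap eβ cap step s l b₀ = l.foldl (fun b a => step s a b) b₀ := by
  unfold foldlCap
  have key : ∀ l₂ l₁ : List α, l₁ ++ l₂ = l →
      l₂.foldl (fun b a => if (eβ (step s a b)).length ≤ cap then step s a b else b) (l₁.foldl (fun b a => step s a b) b₀) =
        l.foldl (fun b a => step s a b) b₀ := by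
    intro l₂
    induction l₂ with
    | nil => intro l₁ h; rw [List.append_nil] at h; subst h; rfl
    | cons a l₂ ih =>
      intro l₁ hl
      rw [List.foldl_cons]
      have h1 : (eβ (step s a (l₁.foldl (fun b a => step s a b) b₀))).length ≤ cap := by
        have := h (l₁ ++ [a]) l₂ (by rw [List.append_assoc, List.singleton_append, hl])
        rwa [List.foldl_append, List.foldl_cons, List.foldl_nil] at this
      rw [if_pos h1, show step s a (l₁.foldl (fun b a => step s a b) b₀) = (l₁ ++ [a]).foldl (fun b a => step s a b) b₀ by
        rw [List.foldl_append, List.foldl_cons, List.foldl_nil]]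
      exact ih (l₁ ++ [a]) (by rw [List.append_assoc, List.singleton_append, hl])
  exact key l [] (List.nil_append l)

/-- The length of a code, as a unary numeral. [folklore] -/
theorem codeLength (eβ : β → List Bool) : CodeFP eβ unE (fun b => (eβ b).length) :=
  strLength.comp (CodeFP.transparent (eα := eβ) (eβ := strE) (g := eβ) fun _ => rfl)

/-- **The capped fold is typed polynomial time** for a typed step and start, with the cap given
in unary. [cite: AroraBarak2009, §1.3] -/
theorem foldlCap_codeFP {step : σ → α → β → β} {init : σ → β}
    (hstep : CodeFP (pairE eσ (pairE eα eβ)) eβ (fun t => step t.1 t.2.1 t.2.2)) (hinit : CodeFP eσ eβ init) :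
    CodeFP (pairE (pairE unE eσ) (rawE eα)) eβ (fun p => foldlCap eβ p.1.1 step p.1.2 p.2 (init p.1.2)) := by
  have hinit' : CodeFP (pairE unE eσ) eβ (fun c => init c.2) := hinit.comp (snd _ _)
  obtain ⟨I, hI, hIs⟩ := hinit
  obtain ⟨P, hP⟩ := exists_poly_length_le_of_mem_FP hI
  -- the guarded step on the context `(cap, s)`
  have hs' : CodeFP (pairE (pairE unE eσ) (pairE eα eβ)) eβ (fun t => step t.1.2 t.2.1 t.2.2) :=
    hstep.comp ((fst _ _).snd'.pair (snd _ _))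
  have hcap : CodeFP (pairE (pairE unE eσ) (pairE eα eβ)) unE (fun t => t.1.1) := (fst _ _).fst'
  have hlen : CodeFP (pairE (pairE unE eσ) (pairE eα eβ)) unE (fun t => (eβ (step t.1.2 t.2.1 t.2.2)).length) :=
    (codeLength eβ).comp hs'
  have htest : CodeFP (pairE (pairE unE eσ) (pairE eα eβ)) bitE (fun t => decide ((eβ (step t.1.2 t.2.1 t.2.2)).length ≤ t.1.1)) := by
    exact (unLeNat.comp (hlen.pair (natOfUn.comp hcap)) :)
  have hold : CodeFP (pairE (pairE unE eσ) (pairE eα eβ)) eβ (fun t => t.2.2) := (snd _ _).snd'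
  have hg := htest.ite hs' hold
  have hfold := CodeFP.foldl (step := fun (c : ℕ × σ) (a : α) (b : β) => if decide ((eβ (step c.2 a b)).length ≤ c.1) then step c.2 a b else b)
    (init := fun c => init c.2) hg hinit' (Polynomial.X + P) fun c l₁ l₂ => by
    have e : l₁.foldl (fun b a => if decide ((eβ (step c.2 a b)).length ≤ c.1) then step c.2 a b else b) (init c.2) =
        foldlCap eβ c.1 step c.2 l₁ (init c.2) := by simp only [foldlCap, decide_eq_true_eq]
    have h1 := length_foldlCap_le (eβ := eβ) c.1 step c.2 l₁ (init c.2)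
    have h2 : (eβ (init c.2)).length ≤ P.eval (eσ c.2).length := by rw [← hIs]; exact hP _
    set N := (pairE (pairE unE eσ) (rawE eα) (c, l₁ ++ l₂)).length with hN
    have hN' : N = 2 * (2 * c.1 + 2 + (eσ c.2).length) + 2 + (rawE eα (l₁ ++ l₂)).length := by
      simp only [hN, pairE_apply, length_boolPair, length_unE]
    have hcN : c.1 ≤ N := by omega
    have hsN : (eσ c.2).length ≤ N := by omega
    rw [e, Polynomial.eval_add, Polynomial.eval_X]
    refine h1.trans (max_le (hcN.trans (Nat.le_add_right _ _)) ((h2.trans (TM2Iter.eval_mono P hsN)).trans (Nat.le_add_left _ _)))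
  exact hfold.congr fun p => by simp only [foldlCap, decide_eq_true_eq]

/-- **The compiler's scan for the best item, with a context-dependent key, is typed polynomial
time** (the accumulator is the default or a list item). [cite: AharonovArad2011, §3.3] -/
theorem bestByCtx (better : ZPhiS → ZPhiS → Bool) (hbetter : CodeFP (pairE zphisE zphisE) bitE (fun p => better p.1 p.2))
    {key : σ × α → ZPhiS} (hkey : CodeFP (pairE eσ eα) zphisE key) :
    CodeFP (pairE (pairE eσ eα) (rawE eα)) eα (fun p => bestBy better (fun x => key (p.1.1, x)) p.1.2 p.2) := by
  -- context `(s, d)`, items `x`, accumulator `b`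
  have hs : CodeFP (pairE (pairE eσ eα) (pairE eα eα)) eσ (fun t => t.1.1) := (fst _ _).fst'
  have hx : CodeFP (pairE (pairE eσ eα) (pairE eα eα)) eα (fun t => t.2.1) := (snd _ _).fst'
  have hb : CodeFP (pairE (pairE eσ eα) (pairE eα eα)) eα (fun t => t.2.2) := (snd _ _).snd'
  have hkx : CodeFP (pairE (pairE eσ eα) (pairE eα eα)) zphisE (fun t => key (t.1.1, t.2.1)) := hkey.comp (hs.pair hx)
  have hkb : CodeFP (pairE (pairE eσ eα) (pairE eα eα)) zphisE (fun t => key (t.1.1, t.2.2)) := hkey.comp (hs.pair hb)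
  have htest : CodeFP (pairE (pairE eσ eα) (pairE eα eα)) bitE (fun t => better (key (t.1.1, t.2.1)) (key (t.1.1, t.2.2))) := by
    exact (hbetter.comp (hkx.pair hkb) :)
  have hstep := htest.ite hx hb
  refine (CodeFP.foldl (step := fun (c : σ × α) (x b : α) => if better (key (c.1, x)) (key (c.1, b)) then x else b)
    (init := fun c => c.2) hstep (snd _ _) Polynomial.X fun c l₁ l₂ => ?_).congr fun p => rfl
  have hN : (pairE (pairE eσ eα) (rawE eα) (c, l₁ ++ l₂)).length =
      2 * (2 * (eσ c.1).length + 2 + (eα c.2).length) + 2 + ((rawE eα l₁).length + (rawE eα l₂).length) := by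
    simp only [pairE_apply, length_boolPair, rawE_append, List.length_append]
  rw [Polynomial.eval_X, hN]
  have hb : bestBy better (fun x => key (c.1, x)) c.2 l₁ = l₁.foldl (fun b x => if better (key (c.1, x)) (key (c.1, b)) then x else b) c.2 := rfl
  rcases bestBy_mem better (fun x => key (c.1, x)) c.2 l₁ with h | h
  · rw [hb] at h; rw [h]; omega
  · rw [hb] at h
    have := length_item_le_length_rawE eα h
    omega

/-- Powers as a fold over a unary exponent. [folklore] -/
theorem Cand.pow_eq_foldl {Γ : Type} (c : Cand Γ) (n : ℕ) : c.pow n = (List.replicate n ()).foldl (fun b _ => b.mul c) Cand.one := by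
  induction n with
  | zero => rfl
  | succ n ih => rw [Cand.pow, ih, List.replicate_succ', List.foldl_append, List.foldl_cons, List.foldl_nil]

/-- **Capped powers**: `c^n` computed by the capped fold (equal to `c^n` when no intermediate code
exceeds the cap). [folklore] -/
def powCap (cap : ℕ) (c : Cand Letter) (n : ℕ) : Cand Letter :=
  foldlCap candE cap (fun (c : Cand Letter) (_ : Unit) b => b.mul c) c (List.replicate n ()) Cand.one

/-- `powCap = pow` below the cap. [folklore] -/
theorem powCap_eq_pow {cap : ℕ} {c : Cand Letter} {n : ℕ} (h : ∀ k ≤ n, (candE (c.pow k)).length ≤ cap) : powCap cap c n = c.pow n := by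
  rw [powCap, Cand.pow_eq_foldl]
  refine foldlCap_eq_foldl fun l₁ l₂ hl => ?_
  have hlen : l₁.length ≤ n := by
    have := congrArg List.length hl; rw [List.length_append, List.length_replicate] at this; omega
  have e : l₁ = List.replicate l₁.length () := List.eq_replicate_iff.2 ⟨rfl, fun u _ => by cases u; rfl⟩
  rw [e, ← Cand.pow_eq_foldl]
  exact h _ hlen

/-- **Capped powers are typed polynomial time** (cap and exponent in unary). [cite: AharonovArad2011, §3.3] -/
theorem powCap_codeFP : CodeFP (pairE (pairE unE candE) unE) candE (fun p => powCap p.1.1 p.1.2 p.2) := by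
  have hstep : CodeFP (pairE candE (pairE unitE candE)) candE (fun t => t.2.2.mul t.1) := candMul' ((snd _ _).snd') (fst _ _)
  have h := foldlCap_codeFP (eβ := candE) (eα := unitE) (step := fun (c : Cand Letter) (_ : Unit) (b : Cand Letter) => b.mul c)
    (init := fun _ => Cand.one) hstep (const _ Cand.one)
  exact (h.comp ((fst _ _).pair (replicateUnit.comp (snd _ _)))).congr fun p => rfl

end Folds


end Literature.Computability.QuantumComplexity
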